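import Summits.CriticalPhenomena.SAWScalingLimit.Theorems.SAWDefectDecoherenceObservableToSLERTwoPieceAdmIdentificationWalks
import HarnessLib

/-!
# Crux `SAWDefectDecoherence.ObservableToSLER` (stmt-CriticalPhenomena-14005), line
`bridge-gate-renewal` (r7), stub 5a3 `stub_twoPieceAdmIdentification`: honeycomb walks in a flat
half-ball (connectivity above the floor row, exit below the floor)

Landing target:
`Summits/CriticalPhenomena/SAWScalingLimit/Theorems/SAWDefectDecoherenceObservableToSLERTwoPieceAdmIdentificationFlat.lean`
(`--supports stmt-CriticalPhenomena-14005`).  Sequel of `…TwoPieceAdmIdentificationWalks`.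

Near a marked point `p` of a two-piece flat Dobrushin domain the domain is the open upper
half-disc `{Im > Im p} ∩ B(p, ρ)` and an admissible vertex family is the exact upper half-lattice
`{rows ≥ m}` there.  This file supplies the two lattice facts about this rigid zone used by the
admissible sub-families of stub 5a3:

* `pathIn_flat_of_high`, `pathIn_flat_of_low` — **half-ball connectivity above the floor row**:
  vertices close to `p` above the threshold height `H` of the floor row, and vertices near the hub
  `p + iL`, are joined to every hub vertex through vertices within `3L` of `p` at height `≥ H`
  (greedy ascent keeps heights, greedy descent towards the hub);
* `not_mem_of_below_floor` — **exit below the floor**: a vertex of the flat ball at height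
  `≤ Im p - 2δ` is not in the family (the rows `≥ m` all lie strictly above the floor line).
-/

noncomputable section

open scoped Topology
open Filter Set Metric
open Literature.Probability.LatticeModels (HexVertex hexGraph hexCenter Site)
open Literature.Probability.RandomPlanarGeometry
open Literature.Probability.RandomPlanarGeometry.SAW
open Literature.Probability.Percolation (PathIn)

namespace Summit.CriticalPhenomena.SAWScalingLimit.Theorems.ObservableToSLER.TwoPiece

open Summit.CriticalPhenomena.SAWScalingLimit.Theorems.ObservableToSLE.FloorRatio

/-! ### Half-ball connectivity above a flat floor -/

/-- **From near the hub to a hub vertex.**  Let `p ∈ ℂ`, `L ≥ 8δ > 0`, `H ≤ Im p + L/2`, and let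
the hub be `y* = p + iL`.  Every vertex `v` within `L/4` of `y*` is joined to every vertex `z`
within `δ` of `y*` through vertices `u` with `dist (δ c_u) p < 3L` and `H ≤ Im (δ c_u)` (greedy
descent to `y*`, then to `δ c_z`). [folklore] -/
theorem pathIn_flat_of_high {δ L H : ℝ} {p : ℂ} (hδ : 0 < δ) (hL : 8 * δ ≤ L)
    (hH : H ≤ p.im + L / 2) {v : HexVertex}
    (hv : dist ((δ : ℂ) * hexCenter v) (p + (L : ℂ) * Complex.I) ≤ L / 4) {z : HexVertex}
    (hz : dist ((δ : ℂ) * hexCenter z) (p + (L : ℂ) * Complex.I) ≤ δ) :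
    PathIn hexGraph {u | dist ((δ : ℂ) * hexCenter u) p < 3 * L ∧ H ≤ ((δ : ℂ) * hexCenter u).im}
      v z := by
  set y : ℂ := p + (L : ℂ) * Complex.I with hy
  have hyim : y.im = p.im + L := by simp [hy]
  have hyp : dist y p = L := by
    rw [hy, dist_eq_norm, add_sub_cancel_left, norm_mul, Complex.norm_real, Complex.norm_I,
      mul_one, Real.norm_of_nonneg (by linarith)]
  have h3 := div_sqrt_three_le hδ.le
  -- membership test: within `L/4 + ...` of the hub
  have hmem : ∀ u : HexVertex, dist ((δ : ℂ) * hexCenter u) y ≤ L / 2 - δ →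
      u ∈ {u | dist ((δ : ℂ) * hexCenter u) p < 3 * L ∧ H ≤ ((δ : ℂ) * hexCenter u).im} := by
    intro u hu
    refine ⟨?_, ?_⟩
    · calc dist ((δ : ℂ) * hexCenter u) p ≤ dist ((δ : ℂ) * hexCenter u) y + dist y p :=
            dist_triangle _ _ _
        _ < 3 * L := by rw [hyp]; linarith
    · have := Complex.abs_im_le_norm ((δ : ℂ) * hexCenter u - y)
      rw [← dist_eq_norm, Complex.sub_im, hyim] at this
      have := (abs_le.1 (this.trans hu)).1
      linarith
  obtain ⟨v₁, p₁, hv₁, hp₁⟩ := exists_walk_dist_smul_le hδ v y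
  obtain ⟨p₂, hp₂⟩ := exists_walk_smul_dist_le_dist hδ.le v₁ z
  refine (pathIn_of_walk p₁ fun u hu => hmem u ((hp₁ u hu).trans (hv.trans (by linarith)))).trans
    (pathIn_of_walk p₂ fun u hu => hmem u ?_)
  have h1 := dist_triangle ((δ : ℂ) * hexCenter u) ((δ : ℂ) * hexCenter z) y
  have h2 := hp₂ u hu
  have h3'' := dist_triangle ((δ : ℂ) * hexCenter v₁) y ((δ : ℂ) * hexCenter z)
  have h4 : dist y ((δ : ℂ) * hexCenter z) ≤ δ := by rwa [dist_comm]
  linarith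

/-- **From above the floor near `p` to a hub vertex.**  With `p, L, H, y*` as in
`pathIn_flat_of_high`: every vertex `v` within `L/8` of `p` at height `≥ H` is joined to every
vertex `z` within `δ` of the hub `y* = p + iL` through vertices `u` with `dist (δ c_u) p < 3L` and
`H ≤ Im (δ c_u)` (greedy ascent by `L`, which keeps the height `≥ Im(δ c_v) ≥ H`, then
`pathIn_flat_of_high`). [folklore] -/
theorem pathIn_flat_of_low {δ L H : ℝ} {p : ℂ} (hδ : 0 < δ) (hL : 8 * δ ≤ L)
    (hH : H ≤ p.im + L / 2) {v : HexVertex} (hv : dist ((δ : ℂ) * hexCenter v) p ≤ L / 8)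
    (hvH : H ≤ ((δ : ℂ) * hexCenter v).im) {z : HexVertex}
    (hz : dist ((δ : ℂ) * hexCenter z) (p + (L : ℂ) * Complex.I) ≤ δ) :
    PathIn hexGraph {u | dist ((δ : ℂ) * hexCenter u) p < 3 * L ∧ H ≤ ((δ : ℂ) * hexCenter u).im}
      v z := by
  obtain ⟨v₁, p₁, hv₁, hp₁⟩ := exists_walk_up hδ v (L := L) (by linarith)
  have hv₁' : dist ((δ : ℂ) * hexCenter v₁) (p + (L : ℂ) * Complex.I) ≤ L / 4 :=
    calc dist ((δ : ℂ) * hexCenter v₁) (p + (L : ℂ) * Complex.I)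
        ≤ dist ((δ : ℂ) * hexCenter v₁) ((δ : ℂ) * hexCenter v + (L : ℂ) * Complex.I) +
            dist ((δ : ℂ) * hexCenter v + (L : ℂ) * Complex.I) (p + (L : ℂ) * Complex.I) :=
          dist_triangle _ _ _
      _ ≤ δ + L / 8 := by rw [dist_add_right]; exact add_le_add hv₁ hv
      _ ≤ L / 4 := by linarith
  refine (pathIn_of_walk p₁ fun u hu => ?_).trans (pathIn_flat_of_high hδ hL hH hv₁' hz)
  refine ⟨?_, hvH.trans (hp₁ u hu).1⟩
  have h1 := dist_triangle ((δ : ℂ) * hexCenter u) ((δ : ℂ) * hexCenter v) p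
  have h2 := (hp₁ u hu).2
  linarith

/-! ### Exit below the floor -/

/-- **Exit below the floor.**  Let the domain `Ω` be the open upper half-disc in `B(p, ρ)`, let
the vertex family `Λ ⊆ Ω` (rescaled centres) be the exact rows `≥ m` in `B(p, ρ)`, and let
`4δ ≤ ρ`.  Then a vertex with rescaled centre in `B(p, ρ)` at height `≤ Im p - 2δ` is NOT in `Λ`:
otherwise the threshold height of row `m` would be `≤ Im p - 2δ`, and the lattice vertex nearest
to `p - iδ` (height in `[Im p - 2δ, Im p]`) would be a vertex of `Λ` on or below the floor line.
[folklore] -/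
theorem not_mem_of_below_floor {Ω : Set ℂ} {Λ : Finset HexVertex} {p : ℂ} {ρ δ : ℝ} {m : ℤ}
    (hδ : 0 < δ) (hδρ : 4 * δ ≤ ρ)
    (hflat : Ω ∩ ball p ρ = {z : ℂ | p.im < z.im} ∩ ball p ρ)
    (hΛΩ : ∀ v ∈ Λ, (δ : ℂ) * hexCenter v ∈ Ω)
    (hrow : ∀ v : HexVertex, (δ : ℂ) * hexCenter v ∈ ball p ρ → (v ∈ Λ ↔ m ≤ v.1 1))
    {u : HexVertex} (hu : (δ : ℂ) * hexCenter u ∈ ball p ρ)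
    (hle : ((δ : ℂ) * hexCenter u).im ≤ p.im - 2 * δ) : u ∉ Λ := by
  intro huΛ
  have hH : ((m : ℝ) + 1 / 3) * (δ * (Real.sqrt 3 / 2)) ≤ p.im - 2 * δ :=
    ((row_le_iff_im hδ m u).1 ((hrow u hu).1 huΛ)).trans hle
  -- the lattice vertex nearest to `p - iδ`
  obtain ⟨u', hu'⟩ := exists_vertex_dist_le hδ (p - (δ : ℂ) * Complex.I)
  have hq : (p - (δ : ℂ) * Complex.I).im = p.im - δ := by simp
  have him := Complex.abs_im_le_norm ((δ : ℂ) * hexCenter u' - (p - (δ : ℂ) * Complex.I))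
  rw [← dist_eq_norm, Complex.sub_im, hq] at him
  have him' := abs_le.1 (him.trans hu')
  have hball : (δ : ℂ) * hexCenter u' ∈ ball p ρ := by
    rw [mem_ball]
    calc dist ((δ : ℂ) * hexCenter u') p
        ≤ dist ((δ : ℂ) * hexCenter u') (p - (δ : ℂ) * Complex.I) + dist (p - (δ : ℂ) * Complex.I) p :=
          dist_triangle _ _ _
      _ ≤ δ + δ := by
          refine add_le_add hu' ?_
          rw [dist_eq_norm, sub_sub_cancel_left, norm_neg, norm_mul, Complex.norm_real,
            Complex.norm_I, mul_one, Real.norm_of_nonneg hδ.le]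
      _ < ρ := by linarith
  have hrow' : m ≤ u'.1 1 := (row_le_iff_im hδ m u').2 (by linarith [him'.1])
  have hΩ : (δ : ℂ) * hexCenter u' ∈ Ω ∩ ball p ρ := ⟨hΛΩ u' ((hrow u' hball).2 hrow'), hball⟩
  rw [hflat] at hΩ
  have : p.im < ((δ : ℂ) * hexCenter u').im := hΩ.1
  linarith [him'.2]

/-! ### Registry form -/

/-- **Registered sub-goal `stub_twoPieceAdmIdentification_flat`** (crux item stmt-CriticalPhenomena-14005, line
`bridge-gate-renewal`, stub `stub_twoPieceAdmIdentification`): registry form of `not_mem_of_below_floor` — exit below the floor of a flat ball. [folklore] -/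
theorem stub_twoPieceAdmIdentification_flat :
    ∀ (Ω : Set ℂ) (Λ : Finset HexVertex) (p : ℂ) (ρ δ : ℝ) (m : ℤ) (u : HexVertex),
      0 < δ → 4 * δ ≤ ρ → Ω ∩ ball p ρ = {z : ℂ | p.im < z.im} ∩ ball p ρ →
      (∀ v ∈ Λ, (δ : ℂ) * hexCenter v ∈ Ω) →
      (∀ v : HexVertex, (δ : ℂ) * hexCenter v ∈ ball p ρ → (v ∈ Λ ↔ m ≤ v.1 1)) →
      (δ : ℂ) * hexCenter u ∈ ball p ρ → ((δ : ℂ) * hexCenter u).im ≤ p.im - 2 * δ → u ∉ Λ :=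
  fun _ _ _ _ _ _ _ hδ hδρ hflat hΛΩ hrow hu hle => not_mem_of_below_floor hδ hδρ hflat hΛΩ hrow hu hle

end Summit.CriticalPhenomena.SAWScalingLimit.Theorems.ObservableToSLER.TwoPiece

end
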